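import Summits.CriticalPhenomena.CardyFormulaZ2.Theorems.CardyUSTContinuationKirchhoffExtremalLengthSlopeLimit
import Summits.CriticalPhenomena.CardyFormulaZ2.Theorems.CardyUSTContinuationKirchhoffExtremalLengthKirchhoff
import Summits.CriticalPhenomena.CardyFormulaZ2.Theorems.CardyUSTContinuationKirchhoffExtremalLengthDefs
import Literature.Probability.RandomPlanarGeometry.ConformalRectangleProofs

/-!
# `KirchhoffExtremalLength` reduced to the convergence of the effective conductance between the
# discrete arcs (the G02-discretisation analogue of [GP19] Corollary 4.15)

Support file for `KirchhoffExtremalLength` (route CardyUSTContinuation of `CardyFormulaZ2`,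
item stmt-CriticalPhenomena-11234). By Kirchhoff's theorem
(`coeff_div_coeff_eq_toReal_effectiveConductance`) the Kirchhoff slope of the jointly-wired
self-dual FK crossing probability of `Ω_δ` is, for small `δ`, the effective conductance
`𝒞(A_δ ↔ B_δ; Ω_δ)` between the discrete arcs `A_δ = rectArc R δ 0`, `B_δ = rectArc R δ 2` of
`Ω_δ = domainSubgraph R.carrier δ` with unit conductances (`slope_eq_toReal_effectiveConductance`).
Hence the item follows from the convergence
`𝒞(A_δ ↔ B_δ; Ω_δ) → d_Ω((ab),(cd))⁻¹` as `δ → 0⁺` for every conformal rectangle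
(`kirchhoffExtremalLength_of_conductance_tendsto`) — Georgakopoulos–Panagiotis,
arXiv:1910.06886, Cor. 4.15, proved in the tree for THEIR discretisation along dyadic meshes
(`GeorgakopoulosPanagiotis2019_cor415_holds`); for the discretisation `meshDomain`/`discreteArc`
of `DomainDiscretisation.lean` and all meshes it is the remaining input.
-/

noncomputable section

namespace Summit.CriticalPhenomena.CardyFormulaZ2.Theorems

namespace KirchhoffSlope

open Filter Topology Polynomial
open Literature.Probability.LatticeModels Literature.Probability.Percolation
open Literature.Probability.RandomPlanarGeometry

/-- **The Kirchhoff slope is the effective conductance between the discrete arcs** (planar form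
of `coeff_div_coeff_eq_toReal_effectiveConductance`): for `δ > 0` such that the discrete arcs of
`(ab)` and `(cd)` are disjoint, `[t^{m+1}] N_δ / [t^m] Z^joint_δ = 𝒞(A_δ ↔ B_δ; Ω_δ)` with unit
conductances. [cite: LyonsPeres2016, §4.2] -/
theorem slope_eq_toReal_effectiveConductance (R : ConformalRectangle) {δ : ℝ} (hδ : 0 < δ)
    (hdisj : discreteArc R.carrier δ (R.arc 0) ∩ discreteArc R.carrier δ (R.arc 2) = ∅) :
    ((fkTwoArcCrossingPolynomial R δ .joint).coeff
          ((fkTwoArcPartitionPolynomials R δ .joint).natTrailingDegree + 1) : ℝ) /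
        ((fkTwoArcPartitionPolynomials R δ .joint).coeff
          (fkTwoArcPartitionPolynomials R δ .joint).natTrailingDegree : ℝ) =
      (effectiveConductance (domainSubgraph R.carrier δ) 1 (rectArc R δ 0) (rectArc R δ 2)).toReal := by
  classical
  letI : Fintype (meshDomain R.carrier δ) := (meshDomain_finite R.isBounded hδ).fintype
  have hdA : Disjoint (rectArc R δ 0) (rectArc R δ 2) := by
    rw [Set.disjoint_iff_inter_eq_empty, rectArc, rectArc, ← Set.preimage_inter, hdisj, Set.preimage_empty]
  rw [fkTwoArcCrossingPolynomial_eq_rcArcPolynomialIn R hδ, fkTwoArcPartitionPolynomials_of_pos R hδ]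
  exact coeff_div_coeff_eq_toReal_effectiveConductance _ _ hdA

/-- **`KirchhoffExtremalLength` follows from the convergence of the effective conductance between
the discrete arcs to the reciprocal extremal distance** (the `meshDomain`/`discreteArc` analogue
of [GP19] Cor. 4.15, for every conformal rectangle and all meshes `δ → 0⁺`).
[cite: GeorgakopoulosPanagiotis2019, Corollary 4.15] -/
theorem kirchhoffExtremalLength_of_conductance_tendsto
    (H : ∀ R : ConformalRectangle, Tendsto (fun δ : ℝ =>
      (effectiveConductance (domainSubgraph R.carrier δ) 1 (rectArc R δ 0) (rectArc R δ 2)).toReal)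
      (𝓝[>] 0)
      (𝓝 ((Literature.Analysis.Complex.extremalDistance R.carrier (R.arc 0) (R.arc 2))⁻¹).toReal)) :
    Summit.CriticalPhenomena.CardyFormulaZ2.Theses.CardyUSTContinuation.KirchhoffExtremalLength := by
  refine kirchhoffExtremalLength_of_slope_tendsto fun R => (H R).congr' ?_
  obtain ⟨δ₀, hδ₀, hdisj⟩ := eventually_discreteArc_inter_eq_empty R
  filter_upwards [Ioo_mem_nhdsGT hδ₀] with δ hδ
  exact (slope_eq_toReal_effectiveConductance R hδ.1 (hdisj δ hδ.1 hδ.2)).symm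

/-! ### The same conductance on the ambient vertex type `Site 2` -/

/-- The energy of a potential on `Ω_δ ⊆ ℤ²` (graph `discreteDomainGraph Ω δ` on all of `Site 2`)
equals the energy of its restriction on the subtype graph `domainSubgraph Ω δ` (unit
conductances): the edges correspond under `Sym2.map Subtype.val`. [folklore] -/
theorem networkEnergy_discreteDomainGraph_eq (Ω : Set ℂ) (δ : ℝ) {v : Site 2 → ℝ}
    {v' : meshDomain Ω δ → ℝ} (hv : ∀ u : meshDomain Ω δ, v u.1 = v' u) :
    networkEnergy (discreteDomainGraph Ω δ) 1 v = networkEnergy (domainSubgraph Ω δ) 1 v' := by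
  unfold networkEnergy
  have hinj : Function.Injective (Sym2.map (Subtype.val : meshDomain Ω δ → Site 2)) :=
    Sym2.map.injective Subtype.val_injective
  rw [← hinj.tsum_eq (f := fun e => (discreteDomainGraph Ω δ).edgeSet.indicator
      (fun e ↦ ((1 : Sym2 (Site 2) → NNReal) e : ENNReal) * ENNReal.ofReal (sqIncr v e)) e)]
  · refine tsum_congr fun e' => ?_
    induction e' using Sym2.ind with
    | h u w =>
      rw [Sym2.map_mk]
      have hiff : s(u.1, w.1) ∈ (discreteDomainGraph Ω δ).edgeSet ↔ s(u, w) ∈ (domainSubgraph Ω δ).edgeSet := by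
        rw [SimpleGraph.mem_edgeSet, SimpleGraph.mem_edgeSet, domainSubgraph, SimpleGraph.comap_adj]
      by_cases h : s(u, w) ∈ (domainSubgraph Ω δ).edgeSet
      · rw [Set.indicator_of_mem (hiff.2 h), Set.indicator_of_mem h]
        simp only [Pi.one_apply, sqIncr_mk, hv u, hv w]
      · rw [Set.indicator_of_notMem (fun h' => h (hiff.1 h')), Set.indicator_of_notMem h]
  · intro e he
    rw [Function.mem_support] at he
    have hmem : e ∈ (discreteDomainGraph Ω δ).edgeSet := by
      by_contra hne
      exact he (Set.indicator_of_notMem hne _)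
    induction e using Sym2.ind with
    | h x y =>
      rw [SimpleGraph.mem_edgeSet, discreteDomainGraph_adj_iff] at hmem
      exact ⟨s(⟨x, hmem.2.1⟩, ⟨y, hmem.2.2⟩), by rw [Sym2.map_mk]⟩

/-- **The effective conductance between two subsets of `Ω_δ` is the same on the ambient graph
`discreteDomainGraph Ω δ` (all other sites isolated) as on the subtype graph
`domainSubgraph Ω δ`.** [folklore] -/
theorem effectiveConductance_domainSubgraph_eq (Ω : Set ℂ) (δ : ℝ) {A B : Set (Site 2)}
    (hA : A ⊆ meshDomain Ω δ) (hB : B ⊆ meshDomain Ω δ) :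
    effectiveConductance (domainSubgraph Ω δ) 1 (Subtype.val ⁻¹' A) (Subtype.val ⁻¹' B) =
      effectiveConductance (discreteDomainGraph Ω δ) 1 A B := by
  classical
  refine le_antisymm (le_effectiveConductance fun v hvA hvB => ?_) (le_effectiveConductance fun v' hvA hvB => ?_)
  · rw [networkEnergy_discreteDomainGraph_eq Ω δ (v := v) (v' := fun u => v u.1) (fun _ => rfl)]
    exact effectiveConductance_le_networkEnergy (fun u hu => hvA hu) (fun u hu => hvB hu)
  · set v : Site 2 → ℝ := fun x => if hx : x ∈ meshDomain Ω δ then v' ⟨x, hx⟩ else 0 with hvdef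
    have hv : ∀ u : meshDomain Ω δ, v u.1 = v' u := fun u => by simp only [hvdef, u.2, dif_pos]
    rw [← networkEnergy_discreteDomainGraph_eq Ω δ hv]
    refine effectiveConductance_le_networkEnergy (fun x hx => ?_) (fun x hx => ?_)
    · rw [show v x = v' ⟨x, hA hx⟩ from hv ⟨x, hA hx⟩]
      exact hvA (show (⟨x, hA hx⟩ : meshDomain Ω δ) ∈ Subtype.val ⁻¹' A from hx)
    · rw [show v x = v' ⟨x, hB hx⟩ from hv ⟨x, hB hx⟩]
      exact hvB (show (⟨x, hB hx⟩ : meshDomain Ω δ) ∈ Subtype.val ⁻¹' B from hx)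

/-- **`KirchhoffExtremalLength` follows from the convergence of the effective conductance between
the discrete arcs of `Ω_δ ⊆ δℤ²` (graph on `Site 2`) to the reciprocal extremal distance** — the
form closest to the tree's `GeorgakopoulosPanagiotis2019_cor415` (graphs on `Site 2`, arcs as
sets of sites), for the `meshDomain`/`discreteArc` discretisation and all meshes `δ → 0⁺`.
[cite: GeorgakopoulosPanagiotis2019, Corollary 4.15] -/
theorem kirchhoffExtremalLength_of_conductance_tendsto'
    (H : ∀ R : ConformalRectangle, Tendsto (fun δ : ℝ =>
      (effectiveConductance (discreteDomainGraph R.carrier δ) 1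
        (discreteArc R.carrier δ (R.arc 0)) (discreteArc R.carrier δ (R.arc 2))).toReal)
      (𝓝[>] 0)
      (𝓝 ((Literature.Analysis.Complex.extremalDistance R.carrier (R.arc 0) (R.arc 2))⁻¹).toReal)) :
    Summit.CriticalPhenomena.CardyFormulaZ2.Theses.CardyUSTContinuation.KirchhoffExtremalLength := by
  refine kirchhoffExtremalLength_of_conductance_tendsto fun R => ?_
  have heq : ∀ δ, effectiveConductance (domainSubgraph R.carrier δ) 1 (rectArc R δ 0) (rectArc R δ 2) =
      effectiveConductance (discreteDomainGraph R.carrier δ) 1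
        (discreteArc R.carrier δ (R.arc 0)) (discreteArc R.carrier δ (R.arc 2)) := fun δ =>
    effectiveConductance_domainSubgraph_eq R.carrier δ
      ((discreteArc_subset_meshBoundary _ _ _).trans (meshBoundary_subset_meshDomain _ _))
      ((discreteArc_subset_meshBoundary _ _ _).trans (meshBoundary_subset_meshDomain _ _))
  simp_rw [heq]
  exact H R

/-- **`G02ModulusConvergence → KirchhoffExtremalLength`**: the route item reduced to the one
named residual statement of `…Defs.lean` (the `meshDomain`/`discreteArc` analogue of [GP19]
Cor. 4.15). [folklore] -/
theorem kirchhoffExtremalLength_of_G02ModulusConvergence (H : G02ModulusConvergence) :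
    Summit.CriticalPhenomena.CardyFormulaZ2.Theses.CardyUSTContinuation.KirchhoffExtremalLength :=
  kirchhoffExtremalLength_of_conductance_tendsto' H

/-- The effective conductance between the discrete arcs, subtype form `=` ambient form, for a
conformal rectangle. [folklore] -/
theorem effectiveConductance_rectArc_eq (R : ConformalRectangle) (δ : ℝ) :
    effectiveConductance (domainSubgraph R.carrier δ) 1 (rectArc R δ 0) (rectArc R δ 2) =
      effectiveConductance (discreteDomainGraph R.carrier δ) 1
        (discreteArc R.carrier δ (R.arc 0)) (discreteArc R.carrier δ (R.arc 2)) :=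
  effectiveConductance_domainSubgraph_eq R.carrier δ
    ((discreteArc_subset_meshBoundary _ _ _).trans (meshBoundary_subset_meshDomain _ _))
    ((discreteArc_subset_meshBoundary _ _ _).trans (meshBoundary_subset_meshDomain _ _))

/-- **Conversely, `KirchhoffExtremalLength → G02ModulusConvergence`**: the slope of conjunct 1 is
determined (limits along `𝓝[>] 0` are unique), equals the effective conductance for small `δ`
(`slope_eq_toReal_effectiveConductance`), and its crossing limit at any uniformizing datum
(which exists, `MarkedDomain.exists_isUniformizing_holds`) is the reciprocal extremal distance
(`toReal_inv_extremalDistance_arc_eq`). So the route item IS the convergence statement. [folklore] -/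
theorem g02ModulusConvergence_of_kirchhoffExtremalLength
    (h : Summit.CriticalPhenomena.CardyFormulaZ2.Theses.CardyUSTContinuation.KirchhoffExtremalLength) :
    G02ModulusConvergence := by
  intro R
  obtain ⟨s, hs, hlim⟩ := h R
  obtain ⟨φ, x, hφx⟩ := MarkedDomain.exists_isUniformizing_holds R
  have h1 : Tendsto s (𝓝[>] 0) (𝓝 (ordinaryHypergeometric (1 / 2 : ℝ) (1 / 2) 1 (crossRatio x) /
      ordinaryHypergeometric (1 / 2 : ℝ) (1 / 2) 1 (1 - crossRatio x))) := hlim φ x hφx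
  rw [← ModulusIdentification.toReal_inv_extremalDistance_arc_eq R hφx] at h1
  -- the slope is the coefficient ratio, eventually
  have h2 : ∀ᶠ δ in 𝓝[>] (0 : ℝ), s δ =
      ((fkTwoArcCrossingPolynomial R δ .joint).coeff
          ((fkTwoArcPartitionPolynomials R δ .joint).natTrailingDegree + 1) : ℝ) /
        ((fkTwoArcPartitionPolynomials R δ .joint).coeff
          (fkTwoArcPartitionPolynomials R δ .joint).natTrailingDegree : ℝ) := by
    filter_upwards [hs, eventually_tendsto_crossingProb_div R] with δ h3 h4
    exact tendsto_nhds_unique h3 h4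
  -- and the coefficient ratio is the conductance, eventually
  obtain ⟨δ₀, hδ₀, hdisj⟩ := eventually_discreteArc_inter_eq_empty R
  have h3 : ∀ᶠ δ in 𝓝[>] (0 : ℝ), s δ =
      (effectiveConductance (discreteDomainGraph R.carrier δ) 1
        (discreteArc R.carrier δ (R.arc 0)) (discreteArc R.carrier δ (R.arc 2))).toReal := by
    filter_upwards [h2, Ioo_mem_nhdsGT hδ₀] with δ h2δ hδ
    rw [h2δ, slope_eq_toReal_effectiveConductance R hδ.1 (hdisj δ hδ.1 hδ.2), effectiveConductance_rectArc_eq]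
  exact h1.congr' h3

/-- **`KirchhoffExtremalLength ↔ G02ModulusConvergence`.** [folklore] -/
theorem kirchhoffExtremalLength_iff_g02ModulusConvergence :
    Summit.CriticalPhenomena.CardyFormulaZ2.Theses.CardyUSTContinuation.KirchhoffExtremalLength ↔
      G02ModulusConvergence :=
  ⟨g02ModulusConvergence_of_kirchhoffExtremalLength, kirchhoffExtremalLength_of_G02ModulusConvergence⟩

end KirchhoffSlope

end Summit.CriticalPhenomena.CardyFormulaZ2.Theorems
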